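import Summits.Ventures.HodgeRepro2.T5RecordSatakeInertToy

/-!
# The record's spherical Hecke algebra is generated by ONE element, and its characters are its values there

Tier-5 support N3 / §G-N4.2 (seat p3, gen 77). Files 236 / 238 give `k[X] ≃ₐ[k] H(U(1 ⊗ H), K_v)` at the
non-split unramified good places of the record's pair (and at the concrete place `(3)` of `ℚ(i)`). Rows 2–5 of
T5-SATAKE-KERNEL-p3.md on the local package say more concretely: the algebra is `k[T₁]` (generated by one element),
a character is its value at `T₁`, and every value occurs. This file makes the `k[X] ≃ A` form say the same, for ANY
`k`-algebra `A` (the generic section), and reads it on the record's pair: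

* `exists_aeval_bijective` — `Nonempty (k[X] ≃ₐ[k] A) → ∃ T : A, Function.Bijective (aeval T)`;
* `exists_forall_exists_aeval_eq` — every element of `A` is a polynomial in `T`;
* `algHom_ext_of_aeval_bijective` — two characters `A →ₐ[k] C` agreeing at `T` agree;
* `exists_algHom_apply_eq_of_aeval_bijective` — every `c : C` is `χ T` for some character `χ`;
* `exists_generator_record_of_ramificationIdx'_eq_one`, `algHom_ext_record_of_ramificationIdx'_eq_one`,
  `exists_algHom_apply_eq_record_of_ramificationIdx'_eq_one` — on the record's pair at every unramified good
  place with one prime above it (file 236);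
* `exists_generator_record_three` — on `ℚ(i)` at `(3)` with `H₀ = diag(1, 1, −1)` (file 238).

§8(d): uses an L-value-free non-vanishing device: NO.
-/

open Matrix NumberField NumberField.IsCMField IsDedekindDomain IsDedekindDomain.HeightOneSpectrum Module Polynomial
open scoped TensorProduct Pointwise
open Summit.Ventures.HodgeRepro2.T5HeckePermutationModule Summit.Ventures.HodgeRepro2.T5RecordHyperspecial
  Summit.Ventures.HodgeRepro2.T5GlobalLatticeAlmostAll Summit.Ventures.HodgeRepro2.T5FinitePlaceSplitClassification
  Summit.Ventures.HodgeRepro2.T5RecordSatakeIntrinsic Summit.Ventures.HodgeRepro2.T5RecordSatakeToy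
  Summit.Ventures.HodgeRepro2.T5RecordSatakeInertToy Summit.Ventures.HodgeRepro2.T5InertPrimeToy
  Summit.Ventures.HodgeRepro2.T5CMCensusToy

namespace Summit.Ventures.HodgeRepro2.T5RecordSatakeGenerator

section Generic

variable {k A : Type*} [CommSemiring k] [Semiring A] [Algebra k A]

/-- `aeval (e X) = e` for an algebra isomorphism `e : k[X] ≃ₐ[k] A`. -/
theorem aeval_algEquiv_X_apply (e : k[X] ≃ₐ[k] A) (p : k[X]) : aeval (e X) p = e p := by
  rw [← AlgEquiv.coe_toAlgHom, Polynomial.aeval_algHom_apply, Polynomial.aeval_X_left_apply]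

/-- **A monogenic algebra**: `k[X] ≃ₐ[k] A` gives `T : A` with `aeval T : k[X] →ₐ[k] A` bijective. -/
theorem exists_aeval_bijective (h : Nonempty (k[X] ≃ₐ[k] A)) :
    ∃ T : A, Function.Bijective (aeval T : k[X] →ₐ[k] A) :=
  h.elim fun e => ⟨e X, by
    have hfun : ⇑(aeval (e X) : k[X] →ₐ[k] A) = ⇑e := funext (aeval_algEquiv_X_apply e)
    rw [hfun]
    exact e.bijective⟩

/-- Every element of `A` is a polynomial in the generator `T`. -/
theorem exists_forall_exists_aeval_eq (h : Nonempty (k[X] ≃ₐ[k] A)) :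
    ∃ T : A, ∀ a : A, ∃ p : k[X], aeval T p = a :=
  (exists_aeval_bijective h).elim fun T hT => ⟨T, fun a => hT.2 a⟩

variable {C : Type*} [Semiring C] [Algebra k C]

/-- **A character is its value at the generator**: two `k`-algebra maps `A →ₐ[k] C` agreeing at `T` agree. -/
theorem algHom_ext_of_aeval_bijective {T : A} (hT : Function.Bijective (aeval T : k[X] →ₐ[k] A))
    (χ χ' : A →ₐ[k] C) (h : χ T = χ' T) : χ = χ' := by
  refine AlgHom.ext fun a => ?_
  obtain ⟨p, rfl⟩ := hT.2 a
  rw [← Polynomial.aeval_algHom_apply, ← Polynomial.aeval_algHom_apply, h]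

/-- **Every value occurs**: for every `c : C` there is a character `χ : A →ₐ[k] C` with `χ T = c`
(`χ := aeval c ∘ (aeval T)⁻¹`). -/
theorem exists_algHom_apply_eq_of_aeval_bijective {T : A}
    (hT : Function.Bijective (aeval T : k[X] →ₐ[k] A)) (c : C) :
    ∃ χ : A →ₐ[k] C, χ T = c := by
  refine ⟨(aeval c).comp (AlgEquiv.ofBijective (aeval T) hT).symm.toAlgHom, ?_⟩
  have hX : (AlgEquiv.ofBijective (aeval T) hT).symm T = X := by
    apply (AlgEquiv.ofBijective (aeval T) hT).injective
    rw [AlgEquiv.apply_symm_apply]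
    exact (Polynomial.aeval_X T).symm
  rw [AlgHom.comp_apply, AlgEquiv.coe_toAlgHom, hX, Polynomial.aeval_X]

end Generic

section Record

variable (K : Type*) [Field K] [NumberField K] [IsCMField K]
variable (v : HeightOneSpectrum (𝓞 (maximalRealSubfield K))) (w : HeightOneSpectrum (𝓞 K))
  [w.asIdeal.LiesOver v.asIdeal]
variable {r : ℕ} (l : Fin r → 𝓞 K)

/-- **The record's spherical Hecke algebra is generated by one element** at every unramified good place with one
prime above it: `∃ T, aeval T : k[X] →ₐ[k] H(U(1 ⊗ H), K_v)` is bijective (file 236's `k[X]`). -/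
theorem exists_generator_record_of_ramificationIdx'_eq_one (k : Type*) [Field k]
    (hl : Submodule.span (𝓞 (maximalRealSubfield K)) (Set.range l) = ⊤)
    (he : v.asIdeal.ramificationIdx' w.asIdeal = 1) (h1 : (v.asIdeal.primesOver (𝓞 K)).ncard = 1)
    {H : Matrix (Fin 3) (Fin 3) K} (hH : H.IsHermitian) (hdet : IsUnit H.det) (hgood : w ∉ badSet H) :
    ∃ T : (letI := tensorStarRing K v; ↥(heckeAlgebra k (recordHyperspecial K v l H))),
      Function.Bijective (aeval T : k[X] →ₐ[k]
        (letI := tensorStarRing K v; ↥(heckeAlgebra k (recordHyperspecial K v l H)))) :=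
  exists_aeval_bijective
    (nonempty_algEquiv_polynomial_record_of_ramificationIdx'_eq_one K v w l k hl he h1 hH hdet hgood)

/-- **A character of the record's spherical Hecke algebra is its value at the generator** (rows 3 / 5 of
T5-SATAKE-KERNEL-p3.md on the record's pair): there is `T` such that two characters agreeing at `T` agree. -/
theorem algHom_ext_record_of_ramificationIdx'_eq_one (k : Type*) [Field k] (C : Type*) [Semiring C]
    [Algebra k C] (hl : Submodule.span (𝓞 (maximalRealSubfield K)) (Set.range l) = ⊤)
    (he : v.asIdeal.ramificationIdx' w.asIdeal = 1) (h1 : (v.asIdeal.primesOver (𝓞 K)).ncard = 1)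
    {H : Matrix (Fin 3) (Fin 3) K} (hH : H.IsHermitian) (hdet : IsUnit H.det) (hgood : w ∉ badSet H) :
    ∃ T : (letI := tensorStarRing K v; ↥(heckeAlgebra k (recordHyperspecial K v l H))),
      ∀ χ χ' : (letI := tensorStarRing K v; ↥(heckeAlgebra k (recordHyperspecial K v l H))) →ₐ[k] C,
        χ T = χ' T → χ = χ' :=
  (exists_generator_record_of_ramificationIdx'_eq_one K v w l k hl he h1 hH hdet hgood).elim fun T hT =>
    ⟨T, fun χ χ' h => algHom_ext_of_aeval_bijective hT χ χ' h⟩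

/-- **Every value occurs as a character value at the generator** (row 3 of T5-SATAKE-KERNEL-p3.md on the record's
pair). -/
theorem exists_algHom_apply_eq_record_of_ramificationIdx'_eq_one (k : Type*) [Field k] (C : Type*) [Semiring C]
    [Algebra k C] (hl : Submodule.span (𝓞 (maximalRealSubfield K)) (Set.range l) = ⊤)
    (he : v.asIdeal.ramificationIdx' w.asIdeal = 1) (h1 : (v.asIdeal.primesOver (𝓞 K)).ncard = 1)
    {H : Matrix (Fin 3) (Fin 3) K} (hH : H.IsHermitian) (hdet : IsUnit H.det) (hgood : w ∉ badSet H) :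
    ∃ T : (letI := tensorStarRing K v; ↥(heckeAlgebra k (recordHyperspecial K v l H))), ∀ c : C,
      ∃ χ : (letI := tensorStarRing K v; ↥(heckeAlgebra k (recordHyperspecial K v l H))) →ₐ[k] C, χ T = c :=
  (exists_generator_record_of_ramificationIdx'_eq_one K v w l k hl he h1 hH hdet hgood).elim fun T hT =>
    ⟨T, fun c => exists_algHom_apply_eq_of_aeval_bijective hT c⟩

end Record

section Three

variable (L : Type*) [Field L] [CharZero L] [IsCyclotomicExtension {2 ^ 2} ℚ L]

/-- **On `ℚ(i)` at `(3)`, `H₀ = diag(1, 1, −1)`: the record's spherical Hecke algebra is generated by one element**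
(file 238's `k[X]`). -/
theorem exists_generator_record_three (k : Type*) [Field k] {r : ℕ} (l : Fin r → 𝓞 L)
    (hl : Submodule.span (𝓞 (maximalRealSubfield L)) (Set.range l) = ⊤) :
    haveI := numberField L; haveI := isCMField_four L
    ∃ T : (letI := tensorStarRing L (vThreePlus L);
        ↥(heckeAlgebra k (recordHyperspecial L (vThreePlus L) l (gramToy L)))),
      Function.Bijective (aeval T : k[X] →ₐ[k]
        (letI := tensorStarRing L (vThreePlus L);
          ↥(heckeAlgebra k (recordHyperspecial L (vThreePlus L) l (gramToy L))))) :=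
  haveI := numberField L
  haveI := isCMField_four L
  exists_aeval_bijective (nonempty_algEquiv_polynomial_record_three L k l hl)

end Three

end Summit.Ventures.HodgeRepro2.T5RecordSatakeGenerator
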